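import Summits.AtomisticToContinuum.HydrodynamicLimit.Theses.ZenoDiameterTransfer
import HarnessLib

/-!
# Crux `DiluteEntropicTwin` (stmt-AtomisticToContinuum-12207) — typed decomposition, assembly theorem
# in route-edit shape (route ZenoDiameterTransfer; crux-strategist re-audit, RESTATED bin)

`DiluteEntropicTwin_of_subs : X₁ → X₂ → X₃ → X₄ → X₅ → DiluteEntropicTwin`, hypotheses in order =
the five sub-items' statements (inlined over the Statement's cone, as route items must be),
conclusion = the crux BY NAME. The five pieces are the proof structure of the crux's informal
content ("Deng–Hani–Ma Thm 3 for canonical local-Gibbs data + the exact bookkeeping identity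
H(f_s|ψ_s)/N = E_{f₀}Λ₀ − E_{f_s}Λ_s + N⁻¹ log(Z_s/Z₀) + isentropy + ideal-gas asymptotics
N⁻¹ log Z_N → log ∫ρ'_s = 0"):

* X₁ `DiluteFieldTwin` — the dilute FIELD twin: for every classical ideal-gas Euler solution on
  `[0,T')` with unit mass, one admissible dilute diameter sequence `0 < ε'_N < 1/2`,
  `(N+1)ε'³ → 0`, `(N+1)ε'² → ∞`, and flows, with the canonical local Gibbs laws of the data
  probability measures and the empirical fields converging in probability at every `s < T'`
  (Deng–Hani–Ma arXiv:2503.01800 Thm 3 (2), p. 11, for canonical data by a diagonal choice; the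
  crux minus its entropy clause — the open anchor).
* X₂ `TwinEntropyIdentity` — the exact entropy bookkeeping identity along the twin flow, for EVERY
  diameter sequence and flows with probability laws: `klDiv(f_s ‖ ψ_s)/(N+1) =
  ofReal (E_{f₀}Λ₀ − E_{f_s}Λ_s + (log Z_s − log Z₀)/(N+1))`, `Λ_s` = the per-particle tilt
  `(N+1)⁻¹ Σᵢ log g_s(zᵢ)` written through the three empirical fields, `Z_s` the canonical
  partition function with the time-`s` profiles (Liouville invariance of `∫ f log f`, `f₀ = ψ₀`,
  transport of densities on the good set; Yau 1991 §2, Saint-Raymond 2009 Lemma 3.1.1).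
* X₃ `TwinTiltLimit` — law of large numbers for the tilt: field convergence in probability at
  time `s` ⇒ `E_{f_s}Λ_s → 𝓗(s) := ∫ρ'_s(log ρ'_s − 3/2 log(2πθ'_s) − 3/2)` (= `∫∫ M_s log M_s`),
  the uniform integrability of the kinetic energy per particle coming from energy conservation
  and Gaussian moments at time `0`.
* X₄ `IdealIsentropy` — classical ideal-gas Euler flow conserves `𝓗(s)` (specific entropy
  `log(θ^{3/2}/ρ)` is transported and mass is conserved; Majda 1984 §1.1).
* X₅ `TwinPartitionAsymptotics` — `(N+1)ε'³ → 0`, `∫ρ'_s = 1` ⇒ `(N+1)⁻¹ log Z_N(s) → 0`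
  (sequential insertion / union bound below; `Z ≤ (∫ρ')^{N+1}` above; Ruelle 1969 §3.4).

The assembly is not a seam: it (1) extracts the twin from X₁, (2) PROVES unit mass at every
pre-shock time `s` from the field convergence under the probability twin laws (test function
`χ ≡ 1`, `empiricalDensityField_one`), which X₅ consumes at `s` and at `0`, (3) instantiates X₃ at
`0` and at `s` and X₅ at `s` and at `0`, cancels the limits with X₄, and (4) transports the real
limit through `ENNReal.ofReal` onto the identity X₂. Axioms: propext, Classical.choice, Quot.sound.
-/

namespace Summit.AtomisticToContinuum.HydrodynamicLimit.Cruxes.DiluteEntropicTwin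

-- crux workfile copy (Cruxes/DiluteEntropicTwin/Split.lean) of the Theorems-shaped assembly; the Theorems-target copy is attached as item evidence
set_option linter.dupNamespace false

open scoped BigOperators Topology ENNReal
open Filter Set MeasureTheory
open Summit.AtomisticToContinuum.HydrodynamicLimit.Theses.ZenoDiameterTransfer

/-- **Typed decomposition of the crux `DiluteEntropicTwin`** (stmt-AtomisticToContinuum-12207):
the dilute field twin (X₁), the entropy bookkeeping identity (X₂), the tilt law of large numbers
(X₃), isentropy of classical ideal Euler flow (X₄) and the dilute partition asymptotics (X₅) imply
the ENTROPIC twin. Hypotheses = the sub-items' statements verbatim, in order; conclusion = the crux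
by name (route-edit `--glue-by` shape). -/
theorem DiluteEntropicTwin_of_subs
    (h₁ : ∀ (T' : ℝ) (ρ' θ' : ℝ → Literature.MathematicalPhysics.KineticTheory.T3 → ℝ) (u' : ℝ → Literature.MathematicalPhysics.KineticTheory.T3 → Literature.MathematicalPhysics.KineticTheory.V3), Literature.MathematicalPhysics.KineticTheory.IsHardSphereEulerSolution 0 T' ρ' u' θ' → 0 < T' → (∫ x, ρ' 0 x = 1) → ∃ ε' : ℕ → ℝ, (∀ N : ℕ, 0 < ε' N ∧ ε' N < 2⁻¹) ∧ Filter.Tendsto (fun N : ℕ => ((N : ℝ) + 1) * ε' N ^ 3) Filter.atTop (nhds 0) ∧ Filter.Tendsto (fun N : ℕ => ((N : ℝ) + 1) * ε' N ^ 2) Filter.atTop Filter.atTop ∧ ∃ Φ' : (N : ℕ) → Literature.Analysis.FluidPDE.HardSphereFlow (Literature.Analysis.FluidPDE.Torus.geometry (Fin 3)) (ε' N) (N + 1), (∀ N : ℕ, MeasureTheory.IsProbabilityMeasure (Literature.Analysis.FluidPDE.particleLaw (Φ' N) (Literature.Analysis.FluidPDE.canonicalDensity (Literature.Analysis.FluidPDE.Torus.geometry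 (Fin 3)) (ε' N) (N + 1) (Literature.MathematicalPhysics.KineticTheory.localGibbsProfile (ρ' 0) (u' 0) (θ' 0))))) ∧ (∀ s ∈ Set.Ico 0 T', Literature.MathematicalPhysics.KineticTheory.TendstoHydroFieldsAt (fun N => (Literature.Analysis.FluidPDE.particleLaw (Φ' N) (Literature.Analysis.FluidPDE.canonicalDensity (Literature.Analysis.FluidPDE.Torus.geometry (Fin 3)) (ε' N) (N + 1) (Literature.MathematicalPhysics.KineticTheory.localGibbsProfile (ρ' 0) (u' 0) (θ' 0))))) Φ' ρ' u' θ' s))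
    (h₂ : ∀ (T' : ℝ) (ρ' θ' : ℝ → Literature.MathematicalPhysics.KineticTheory.T3 → ℝ) (u' : ℝ → Literature.MathematicalPhysics.KineticTheory.T3 → Literature.MathematicalPhysics.KineticTheory.V3), Literature.MathematicalPhysics.KineticTheory.IsHardSphereEulerSolution 0 T' ρ' u' θ' → ∀ ε' : ℕ → ℝ, (∀ N : ℕ, 0 < ε' N ∧ ε' N < 2⁻¹) → ∀ Φ' : (N : ℕ) → Literature.Analysis.FluidPDE.HardSphereFlow (Literature.Analysis.FluidPDE.Torus.geometry (Fin 3)) (ε' N) (N + 1), (∀ N : ℕ, MeasureTheory.IsProbabilityMeasure (Literature.Analysis.FluidPDE.particleLaw (Φ' N) (Literature.Analysis.FluidPDE.canonicalDensity (Literature.Analysis.FluidPDE.Torus.geometry (Fin 3)) (ε' N) (N + 1) (Literature.MathematicalPhysics.KineticTheory.localGibbsProfile (ρ' 0) (u' 0) (θ' 0))))) → ∀ N : ℕ, ∀ s ∈ Set.Ico 0 T', InformationTheory.klDiv ((Φ' N).lawAt (Literature.Analysis.FluidPDE.particleLaw (Φ' N) (Literature.Analysis.FluidPDE.canonicalDensity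 (Literature.Analysis.FluidPDE.Torus.geometry (Fin 3)) (ε' N) (N + 1) (Literature.MathematicalPhysics.KineticTheory.localGibbsProfile (ρ' 0) (u' 0) (θ' 0)))) s) (Literature.Analysis.FluidPDE.particleLaw (Φ' N) (Literature.Analysis.FluidPDE.canonicalDensity (Literature.Analysis.FluidPDE.Torus.geometry (Fin 3)) (ε' N) (N + 1) (Literature.MathematicalPhysics.KineticTheory.localGibbsProfile (ρ' s) (u' s) (θ' s)))) / ((N : ENNReal) + 1) = ENNReal.ofReal ((∫ z, (Literature.MathematicalPhysics.KineticTheory.empiricalDensityField z (fun x => Real.log (ρ' 0 x) - 3 / 2 * Real.log (2 * Real.pi * θ' 0 x) - ‖u' 0 x‖ ^ 2 / (2 * θ' 0 x)) + (∑ k : Fin 3, Literature.MathematicalPhysics.KineticTheory.empiricalMomentumField z (fun x => (u' 0 x) k / θ' 0 x) k) - Literature.MathematicalPhysics.KineticTheory.empiricalEnergyField z (fun x => (θ' 0 x)⁻¹)) ∂((Φ' N).lawAt (Literature.Analysis.FluidPDE.particleLaw (Φ' N) (Literature.Analysis.FluidPDE.canonicalDensity (Literature.Analysis.FluidPDE.Torus.geometry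 (Fin 3)) (ε' N) (N + 1) (Literature.MathematicalPhysics.KineticTheory.localGibbsProfile (ρ' 0) (u' 0) (θ' 0)))) 0)) - (∫ z, (Literature.MathematicalPhysics.KineticTheory.empiricalDensityField z (fun x => Real.log (ρ' s x) - 3 / 2 * Real.log (2 * Real.pi * θ' s x) - ‖u' s x‖ ^ 2 / (2 * θ' s x)) + (∑ k : Fin 3, Literature.MathematicalPhysics.KineticTheory.empiricalMomentumField z (fun x => (u' s x) k / θ' s x) k) - Literature.MathematicalPhysics.KineticTheory.empiricalEnergyField z (fun x => (θ' s x)⁻¹)) ∂((Φ' N).lawAt (Literature.Analysis.FluidPDE.particleLaw (Φ' N) (Literature.Analysis.FluidPDE.canonicalDensity (Literature.Analysis.FluidPDE.Torus.geometry (Fin 3)) (ε' N) (N + 1) (Literature.MathematicalPhysics.KineticTheory.localGibbsProfile (ρ' 0) (u' 0) (θ' 0)))) s)) + (Real.log (Literature.Analysis.FluidPDE.canonicalPartition (Literature.Analysis.FluidPDE.Torus.geometry (Fin 3)) (ε' N) (N + 1) (Literature.MathematicalPhysics.KineticTheory.localGibbsProfile (ρ' s) (u' s) (θ' s))) / ((N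 : ℝ) + 1) - Real.log (Literature.Analysis.FluidPDE.canonicalPartition (Literature.Analysis.FluidPDE.Torus.geometry (Fin 3)) (ε' N) (N + 1) (Literature.MathematicalPhysics.KineticTheory.localGibbsProfile (ρ' 0) (u' 0) (θ' 0))) / ((N : ℝ) + 1))))
    (h₃ : ∀ (T' : ℝ) (ρ' θ' : ℝ → Literature.MathematicalPhysics.KineticTheory.T3 → ℝ) (u' : ℝ → Literature.MathematicalPhysics.KineticTheory.T3 → Literature.MathematicalPhysics.KineticTheory.V3), Literature.MathematicalPhysics.KineticTheory.IsHardSphereEulerSolution 0 T' ρ' u' θ' → ∀ ε' : ℕ → ℝ, (∀ N : ℕ, 0 < ε' N ∧ ε' N < 2⁻¹) → ∀ Φ' : (N : ℕ) → Literature.Analysis.FluidPDE.HardSphereFlow (Literature.Analysis.FluidPDE.Torus.geometry (Fin 3)) (ε' N) (N + 1), (∀ N : ℕ, MeasureTheory.IsProbabilityMeasure (Literature.Analysis.FluidPDE.particleLaw (Φ' N) (Literature.Analysis.FluidPDE.canonicalDensity (Literature.Analysis.FluidPDE.Torus.geometry (Fin 3)) (ε' N) (N + 1) (Literature.MathematicalPhysics.KineticTheory.localGibbsProfile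 (ρ' 0) (u' 0) (θ' 0))))) → ∀ s ∈ Set.Ico 0 T', Literature.MathematicalPhysics.KineticTheory.TendstoHydroFieldsAt (fun N => (Literature.Analysis.FluidPDE.particleLaw (Φ' N) (Literature.Analysis.FluidPDE.canonicalDensity (Literature.Analysis.FluidPDE.Torus.geometry (Fin 3)) (ε' N) (N + 1) (Literature.MathematicalPhysics.KineticTheory.localGibbsProfile (ρ' 0) (u' 0) (θ' 0))))) Φ' ρ' u' θ' s → Filter.Tendsto (fun N : ℕ => (∫ z, (Literature.MathematicalPhysics.KineticTheory.empiricalDensityField z (fun x => Real.log (ρ' s x) - 3 / 2 * Real.log (2 * Real.pi * θ' s x) - ‖u' s x‖ ^ 2 / (2 * θ' s x)) + (∑ k : Fin 3, Literature.MathematicalPhysics.KineticTheory.empiricalMomentumField z (fun x => (u' s x) k / θ' s x) k) - Literature.MathematicalPhysics.KineticTheory.empiricalEnergyField z (fun x => (θ' s x)⁻¹)) ∂((Φ' N).lawAt (Literature.Analysis.FluidPDE.particleLaw (Φ' N) (Literature.Analysis.FluidPDE.canonicalDensity (Literature.Analysis.FluidPDE.Torus.geometry (Fin 3)) (ε' N)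 (N + 1) (Literature.MathematicalPhysics.KineticTheory.localGibbsProfile (ρ' 0) (u' 0) (θ' 0)))) s))) Filter.atTop (nhds (∫ x, ρ' s x * (Real.log (ρ' s x) - 3 / 2 * Real.log (2 * Real.pi * θ' s x) - 3 / 2))))
    (h₄ : ∀ (T' : ℝ) (ρ' θ' : ℝ → Literature.MathematicalPhysics.KineticTheory.T3 → ℝ) (u' : ℝ → Literature.MathematicalPhysics.KineticTheory.T3 → Literature.MathematicalPhysics.KineticTheory.V3), Literature.MathematicalPhysics.KineticTheory.IsHardSphereEulerSolution 0 T' ρ' u' θ' → ∀ s ∈ Set.Ico 0 T', (∫ x, ρ' s x * (Real.log (ρ' s x) - 3 / 2 * Real.log (2 * Real.pi * θ' s x) - 3 / 2)) = (∫ x, ρ' 0 x * (Real.log (ρ' 0 x) - 3 / 2 * Real.log (2 * Real.pi * θ' 0 x) - 3 / 2)))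
    (h₅ : ∀ (T' : ℝ) (ρ' θ' : ℝ → Literature.MathematicalPhysics.KineticTheory.T3 → ℝ) (u' : ℝ → Literature.MathematicalPhysics.KineticTheory.T3 → Literature.MathematicalPhysics.KineticTheory.V3), Literature.MathematicalPhysics.KineticTheory.IsHardSphereEulerSolution 0 T' ρ' u' θ' → ∀ ε' : ℕ → ℝ, (∀ N : ℕ, 0 < ε' N ∧ ε' N < 2⁻¹) → Filter.Tendsto (fun N : ℕ => ((N : ℝ) + 1) * ε' N ^ 3) Filter.atTop (nhds 0) → ∀ Φ' : (N : ℕ) → Literature.Analysis.FluidPDE.HardSphereFlow (Literature.Analysis.FluidPDE.Torus.geometry (Fin 3)) (ε' N) (N + 1), (∀ N : ℕ, MeasureTheory.IsProbabilityMeasure (Literature.Analysis.FluidPDE.particleLaw (Φ' N) (Literature.Analysis.FluidPDE.canonicalDensity (Literature.Analysis.FluidPDE.Torus.geometry (Fin 3)) (ε' N) (N + 1) (Literature.MathematicalPhysics.KineticTheory.localGibbsProfile (ρ' 0) (u' 0) (θ' 0))))) → ∀ s ∈ Set.Ico 0 T', (∫ x, ρ' s x = 1) → Filter.Tendsto (fun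 N : ℕ => Real.log (Literature.Analysis.FluidPDE.canonicalPartition (Literature.Analysis.FluidPDE.Torus.geometry (Fin 3)) (ε' N) (N + 1) (Literature.MathematicalPhysics.KineticTheory.localGibbsProfile (ρ' s) (u' s) (θ' s))) / ((N : ℝ) + 1)) Filter.atTop (nhds 0))
    : DiluteEntropicTwin := by
  intro T' ρ' θ' u' hE hT hmass
  obtain ⟨ε', hε', h3, h2, Φ', hprob, hconv⟩ := h₁ T' ρ' θ' u' hE hT hmass
  refine ⟨ε', hε', h3, h2, Φ', hprob, hconv, ?_⟩
  intro s hs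
  have h0 : (0 : ℝ) ∈ Set.Ico 0 T' := ⟨le_rfl, hT⟩
  -- Step 1 (mass normalisation at time `s`, test function χ ≡ 1 under the probability twin laws).
  have hmass_s : ∫ x, ρ' s x = 1 := by
    by_contra hne
    have habs : 0 < |1 - ∫ x, ρ' s x| := abs_pos.mpr (sub_ne_zero.mpr (Ne.symm hne))
    obtain ⟨hd, -, -⟩ := hconv s hs (fun _ => (1 : ℝ)) continuous_const (|1 - ∫ x, ρ' s x| / 2)
      (half_pos habs)
    have hconst : ∀ N : ℕ,
        (Literature.Analysis.FluidPDE.particleLaw (Φ' N)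
          (Literature.Analysis.FluidPDE.canonicalDensity (Literature.Analysis.FluidPDE.Torus.geometry (Fin 3))
            (ε' N) (N + 1)
            (Literature.MathematicalPhysics.KineticTheory.localGibbsProfile (ρ' 0) (u' 0) (θ' 0))))
          {z | |1 - ∫ x, ρ' s x| / 2 <
            |Literature.MathematicalPhysics.KineticTheory.empiricalDensityField ((Φ' N).flow s z)
                (fun _ => (1 : ℝ)) - ∫ x, (fun _ => (1 : ℝ)) x * ρ' s x|} = 1 := by
      intro N
      haveI := hprob N
      have hset : {z : Literature.Analysis.FluidPDE.Config (N + 1) (Fin 3)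
          Literature.MathematicalPhysics.KineticTheory.T3 | |1 - ∫ x, ρ' s x| / 2 <
            |Literature.MathematicalPhysics.KineticTheory.empiricalDensityField ((Φ' N).flow s z)
                (fun _ => (1 : ℝ)) - ∫ x, (fun _ => (1 : ℝ)) x * ρ' s x|} = Set.univ := by
        refine Set.eq_univ_of_forall fun z => ?_
        simp only [Set.mem_setOf_eq, one_mul,
          Literature.MathematicalPhysics.KineticTheory.empiricalDensityField_one (Nat.succ_ne_zero N)]
        exact half_lt_self habs
      rw [hset, measure_univ]
    have hlim : Filter.Tendsto (fun _ : ℕ => (1 : ℝ≥0∞)) Filter.atTop (nhds 0) :=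
      hd.congr' (Filter.Eventually.of_forall hconst)
    exact one_ne_zero (tendsto_nhds_unique tendsto_const_nhds hlim)
  -- Step 2 (the four limits).
  have hA := h₃ T' ρ' θ' u' hE ε' hε' Φ' hprob 0 h0 (hconv 0 h0)
  have hB := h₃ T' ρ' θ' u' hE ε' hε' Φ' hprob s hs (hconv s hs)
  have hC := h₅ T' ρ' θ' u' hE ε' hε' h3 Φ' hprob s hs hmass_s
  have hD := h₅ T' ρ' θ' u' hE ε' hε' h3 Φ' hprob 0 h0 hmass
  have hiso := h₄ T' ρ' θ' u' hE s hs
  -- Step 3 (bookkeeping identity + limit algebra).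
  have hlim := ENNReal.tendsto_ofReal ((hA.sub hB).add (hC.sub hD))
  rw [hiso, sub_self, sub_self, add_zero, ENNReal.ofReal_zero] at hlim
  refine hlim.congr' (Filter.Eventually.of_forall fun N => ?_)
  exact (h₂ T' ρ' θ' u' hE ε' hε' Φ' hprob N s hs).symm

end Summit.AtomisticToContinuum.HydrodynamicLimit.Cruxes.DiluteEntropicTwin
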